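import Mathlib
import Summits.ValiantsHypothesis.ValiantsHypothesis.Theorems.BarrierLeverPartitionMinorsHitByVPHiddenStatesCoStarLeaves
import Summits.ValiantsHypothesis.ValiantsHypothesis.Theorems.BarrierLeverPartitionMinorsHitByVPHiddenStatesCoordEmbed
import Summits.ValiantsHypothesis.ValiantsHypothesis.Theorems.BarrierLeverPartitionMinorsHitByVPHiddenStatesFlagCells

/-!
# Route BarrierLever — item `PartitionMinorsHitByVP` (stmt-ValiantsHypothesis-19717), line `hidden-states`:
# THE CORE LIFT — a lower cell `(h, 2^h − c)` lifts to `(h + 1, 2^{h+1} − c)` whenever `c ≤ h + 1`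

Helper file (`--supports stmt-ValiantsHypothesis-19717`; cell valiant-natproofs, rung V4, 𝒟-side door (c), registered line
`Cruxes/PartitionMinorsHitByVP/Lines/hidden_states.lean` v7; prover seat val-np-p6 gen 12). Definition-free; closes NO item.

THE POINT. A down-set `U ⊆ 2^{[h+1]}` of co-size `c ≤ h + 1` has a CORE coordinate `x` (a coordinate lying in every missing set,
`FlagCells.card_noncore_succ_le`): every set avoiding `x` is a member. So `U = 2^{[h+1] ∖ x} ⊔ x·R′` with `R′` a down-set of
co-size `c` in the `h`-cube `[h+1] ∖ x`. Take ANY legal wide design `e` at level `h` that serves every lower row family of size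
`2^h − c`, add ONE new piece — a full cube on `h` fresh states — and keep the old pieces on the old states. With the cut «`x`-coordinate
of the hidden point = `0` on the cube piece, `= 1` on the old pieces» the symbolic matrix is block-triangular
(`SymbJoin.symGood_of_split_enum`, p3 g10): the deletion block is the full-cube leaf (`symGood_subcube_full`, p620021) and the link block
is the level-`h` configuration `(R′, e)` transported along `Fin.succAbove x` (`symGood_map_embedding`, p592006) and along the
piece/state re-indexing (`symGood_map_pieces`, here). Budget: `m + 1 ≤ 2(h+1)` pieces, `K + h ≤ (h+1)³` states; the joint strict
threshold survives (old offsets shifted by one, fresh states of old pieces and old states of the new piece made heavy).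

* `symDet_map_pieces`, `symGood_map_pieces` — generic goodness is invariant under injective re-indexing of pieces and states.
* `symGood_lift` — the symbolic lift theorem (any enumerations).
* **`universalJoinWideLower_lift`** — the numeric node form: the body of `LowerNode.Stmt.universalJoinWideLower` (p599518) at
  `(h, 2^h − c)` implies the body at `(h + 1, 2^{h+1} − c)` for `c ≤ h + 1`, `c ≤ 2^h`. The iteration and the cells it yields
  (lower node at `(h, 2^h − c)` for all `h ≥ 18`, `c ≤ 19`; `h = 19`: `r ≥ 524 269`) are in the sequel `…CoreLiftCells`.

WHAT THIS IS NOT: the lift needs a core coordinate, so it says nothing at co-size `c ≥ h + 2` (core-less down-sets) nor in the bulk;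
no stub of the line is closed; nothing on crux 14610 or VP ≠ VNP.
-/

set_option linter.dupNamespace false

namespace Summit.ValiantsHypothesis.ValiantsHypothesis.Theorems.BarrierLever.HiddenStates

open Finset Matrix MvPolynomial

noncomputable section

namespace SymbJoin

variable {h m K r : ℕ}

/-! ## 1. Re-indexing pieces and states -/

/-- **The symbolic determinant under an injective re-indexing of pieces and states** is the renamed symbolic determinant. -/
theorem symDet_map_pieces {m' K' : ℕ} (ι : Fin m ↪ Fin m') (κ : Fin K ↪ Fin K') (u : Fin r → Finset (Fin h))
    (e : Fin r → Fin m × Finset (Fin K)) :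
    symDet u (fun k => (ι (e k).1, ((e k).2).map κ))
      = MvPolynomial.rename (fun v : Var m K h => ((ι v.1, v.2.1.map κ, v.2.2) : Var m' K' h)) (symDet u e) := by
  set f : Var m K h → Var m' K' h := fun v => (ι v.1, v.2.1.map κ, v.2.2) with hf
  rw [symDet, symDet, show (MvPolynomial.rename f) (symMat u e).det
      = (MvPolynomial.rename f).toRingHom (symMat u e).det from rfl, RingHom.map_det]
  congr 1
  apply Matrix.ext
  intro i k
  rw [RingHom.mapMatrix_apply, Matrix.map_apply]
  change ∏ a ∈ u i, symPoint (fun k => (ι (e k).1, ((e k).2).map κ)) k a = (MvPolynomial.rename f) (∏ a ∈ u i, symPoint e k a)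
  rw [map_prod]
  refine Finset.prod_congr rfl fun a _ => ?_
  simp [symPoint, hf, map_add, map_sum, MvPolynomial.rename_X, Finset.sum_map]

/-- **Generic goodness is invariant under injective re-indexing of pieces and states.** -/
theorem symGood_map_pieces {m' K' : ℕ} (ι : Fin m ↪ Fin m') (κ : Fin K ↪ Fin K') (u : Fin r → Finset (Fin h))
    (e : Fin r → Fin m × Finset (Fin K)) (hG : symDet u e ≠ 0) :
    symDet u (fun k => (ι (e k).1, ((e k).2).map κ)) ≠ 0 := by
  rw [symDet_map_pieces]
  intro h0
  apply hG
  have hinj : Function.Injective (fun v : Var m K h => ((ι v.1, v.2.1.map κ, v.2.2) : Var m' K' h)) := by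
    rintro ⟨p, o, a⟩ ⟨p', o', a'⟩ hv
    simp only [Prod.mk.injEq] at hv
    obtain ⟨hp, ho, rfl⟩ := hv
    rw [ι.injective hp, Option.map_injective κ.injective ho]
  exact (MvPolynomial.rename_injective _ hinj) (by rw [h0, map_zero])

/-! ## 2. The symbolic lift theorem -/

/-- **THE CORE LIFT (symbolic form).** Let `e` be a level-`h` design that is generically good for every injective lower row family
`w : Fin r₁ → Finset (Fin h)`. Let `u` be an injective lower family of `2^h + r₁` subsets of `Fin (h+1)` with a core coordinate `x`
(every set avoiding `x` is a row). Let `e'` consist of a full cube on a state block `Q` (`|Q| = h`) in a piece `p₀` (columns `g₀`)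
together with the columns of `e` re-indexed into pieces `≠ p₀` (columns `g₁`). Then `(u, e')` is generically good. -/
theorem symGood_lift {h r₁ m K m' K' r : ℕ} (e : Fin r₁ → Fin m × Finset (Fin K))
    (hgood : ∀ w : Fin r₁ → Finset (Fin h), Function.Injective w → IsLowerSet (Set.range w) → symDet w e ≠ 0)
    (u : Fin r → Finset (Fin (h + 1))) (hu : Function.Injective u) (hlow : IsLowerSet (Set.range u))
    (x : Fin (h + 1)) (hx : ∀ S : Finset (Fin (h + 1)), x ∉ S → S ∈ Set.range u)
    (e' : Fin r → Fin m' × Finset (Fin K')) (hr : 2 ^ h + r₁ = r)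
    (g₀ : Fin (2 ^ h) → Fin r) (g₁ : Fin r₁ → Fin r) (hg : Function.Injective (Sum.elim g₀ g₁))
    (p₀ : Fin m') (Q : Finset (Fin K')) (hQ : Q.card = h)
    (cols : Fin (2 ^ h) → Finset (Fin K')) (hcols : Function.Injective cols) (hcolsQ : ∀ i, cols i ⊆ Q)
    (he0 : ∀ i, e' (g₀ i) = (p₀, cols i))
    (ι : Fin m ↪ Fin m') (κ : Fin K ↪ Fin K') (hι : ∀ p, ι p ≠ p₀)
    (he1 : ∀ j, e' (g₁ j) = (ι (e j).1, ((e j).2).map κ)) :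
    symDet u e' ≠ 0 := by
  classical
  -- the rows avoiding / containing `x`
  set R0 : Finset (Fin r) := Finset.univ.filter fun i => x ∉ u i with hR0
  set R1 : Finset (Fin r) := Finset.univ.filter fun i => x ∈ u i with hR1
  have hR0card : R0.card = 2 ^ h := by
    have himg : R0.image u = (Finset.univ.erase x).powerset := by
      ext S
      simp only [Finset.mem_image, Finset.mem_powerset, Finset.subset_erase, Finset.subset_univ, true_and, hR0,
        Finset.mem_filter, Finset.mem_univ]
      constructor
      · rintro ⟨i, hi, rfl⟩; exact hi
      · intro hS; obtain ⟨i, rfl⟩ := hx S hS; exact ⟨i, hS, rfl⟩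
    rw [← Finset.card_image_of_injective R0 hu, himg, Finset.card_powerset, Finset.card_erase_of_mem (Finset.mem_univ x),
      Finset.card_univ, Fintype.card_fin]
    simp
  have hR1card : R1.card = r₁ := by
    have hdisj : Disjoint R0 R1 := by
      rw [Finset.disjoint_left]; intro i hi hi'
      exact (Finset.mem_filter.mp hi).2 (Finset.mem_filter.mp hi').2
    have hunion : R0 ∪ R1 = Finset.univ := by
      ext i; simp only [hR0, hR1, Finset.mem_union, Finset.mem_filter, Finset.mem_univ, true_and, iff_true]; tauto
    have := Finset.card_union_of_disjoint hdisj
    rw [hunion, Finset.card_univ, Fintype.card_fin, hR0card] at this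
    omega
  let f₀ : Fin (2 ^ h) → Fin r := fun j => R0.orderEmbOfFin hR0card j
  let f₁ : Fin r₁ → Fin r := fun j => R1.orderEmbOfFin hR1card j
  have hf₀mem : ∀ j, x ∉ u (f₀ j) := fun j => (Finset.mem_filter.mp (Finset.orderEmbOfFin_mem R0 hR0card j)).2
  have hf₁mem : ∀ j, x ∈ u (f₁ j) := fun j => (Finset.mem_filter.mp (Finset.orderEmbOfFin_mem R1 hR1card j)).2
  have hf₀surj : ∀ i, x ∉ u i → ∃ j, f₀ j = i := by
    intro i hi
    have : i ∈ Set.range (R0.orderEmbOfFin hR0card) := by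
      rw [Finset.range_orderEmbOfFin]; exact Finset.mem_filter.mpr ⟨Finset.mem_univ _, hi⟩
    exact this
  have hf₁surj : ∀ i, x ∈ u i → ∃ j, f₁ j = i := by
    intro i hi
    have : i ∈ Set.range (R1.orderEmbOfFin hR1card) := by
      rw [Finset.range_orderEmbOfFin]; exact Finset.mem_filter.mpr ⟨Finset.mem_univ _, hi⟩
    exact this
  have hf : Function.Injective (Sum.elim f₀ f₁) :=
    Function.Injective.sumElim (fun a b hab => (R0.orderEmbOfFin hR0card).injective hab)
      (fun a b hab => (R1.orderEmbOfFin hR1card).injective hab) (fun a b hab => hf₀mem a (hab ▸ hf₁mem b))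
  -- the cut: `x`-coordinate `0` on the cube piece, `1` on the old pieces
  refine symGood_of_split_enum u e' x (fun p => if p = p₀ then 0 else 1) (fun _ _ => 0) hr f₀ f₁ g₀ g₁ hf hg hf₀mem hf₁mem
    ?_ ?_ ?_ ?_
  · intro j; simp [xi, he0]
  · intro j; simp [xi, he1, hι]
  · -- deletion block: the full-cube leaf
    have hcfg : (fun j => e' (g₀ j)) = fun j => (p₀, cols j) := funext he0
    rw [hcfg]
    refine symGood_subcube_full p₀ (fun j => u (f₀ j)) (hu.comp (R0.orderEmbOfFin hR0card).injective) cols hcols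
      (Finset.univ.erase x) Q ?_ hcolsQ ?_
    · rw [Finset.card_erase_of_mem (Finset.mem_univ x), Finset.card_univ, Fintype.card_fin, hQ]; simp
    · intro S hS
      have hxS : x ∉ S := fun hxS => by simpa using hS hxS
      obtain ⟨i, hi⟩ := hx S hxS
      obtain ⟨j, hj⟩ := hf₀surj i (hi ▸ hxS)
      exact ⟨j, by rw [hj, hi]⟩
  · -- link block: the level-`h` configuration transported along `succAbove x`
    let w : Fin r₁ → Finset (Fin h) := fun j => Finset.univ.filter fun a => x.succAbove a ∈ u (f₁ j)
    have hwmap : ∀ j, (w j).map (Fin.succAboveEmb x) = (u (f₁ j)).erase x := by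
      intro j
      ext b
      simp only [Finset.mem_map, Finset.mem_filter, Finset.mem_univ, true_and, Fin.succAboveEmb_apply, Finset.mem_erase, w]
      constructor
      · rintro ⟨a, ha, rfl⟩; exact ⟨Fin.succAbove_ne x a, ha⟩
      · rintro ⟨hb, hbu⟩
        obtain ⟨a, rfl⟩ := Fin.exists_succAbove_eq hb
        exact ⟨a, hbu, rfl⟩
    have hwinj : Function.Injective w := by
      intro j j' hjj
      have h1 : (u (f₁ j)).erase x = (u (f₁ j')).erase x := by rw [← hwmap, ← hwmap, hjj]
      have h2 : u (f₁ j) = u (f₁ j') := by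
        rw [← Finset.insert_erase (hf₁mem j), ← Finset.insert_erase (hf₁mem j'), h1]
      exact (R1.orderEmbOfFin hR1card).injective (hu h2)
    have hwlow : IsLowerSet (Set.range w) := by
      rintro T' T hTT ⟨j, rfl⟩
      -- `insert x (T.map succAbove) ⊆ u (f₁ j)` is a row containing `x`
      have hsub : insert x (T.map (Fin.succAboveEmb x)) ⊆ u (f₁ j) := by
        intro b hb
        rcases Finset.mem_insert.mp hb with rfl | hb
        · exact hf₁mem j
        · have : b ∈ (w j).map (Fin.succAboveEmb x) := Finset.map_subset_map.mpr hTT hb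
          rw [hwmap] at this
          exact Finset.mem_of_mem_erase this
      obtain ⟨i, hi⟩ := hlow hsub ⟨f₁ j, rfl⟩
      obtain ⟨j', hj'⟩ := hf₁surj i (by rw [hi]; exact Finset.mem_insert_self _ _)
      refine ⟨j', ?_⟩
      apply Finset.map_injective (Fin.succAboveEmb x)
      rw [hwmap, hj', hi, Finset.erase_insert]
      intro hxT
      obtain ⟨a, -, ha⟩ := Finset.mem_map.mp hxT
      exact Fin.succAbove_ne x a ha
    have hG := symGood_map_embedding (Fin.succAboveEmb x) w _ (symGood_map_pieces ι κ w e (hgood w hwinj hwlow))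
    have hcfg : (fun j => e' (g₁ j)) = fun j => (ι (e j).1, ((e j).2).map κ) := funext he1
    have hrows : (fun j => (u (f₁ j)).erase x) = fun j => (w j).map (Fin.succAboveEmb x) := funext fun j => (hwmap j).symm
    rw [hcfg, hrows]
    exact hG

end SymbJoin

/-! ## 3. The numeric lift of the lower node -/

namespace CoreLift

/-- **THE CORE LIFT (node form).** The body of `LowerNode.Stmt.universalJoinWideLower` at `(h, 2^h − c)` implies the body at
`(h + 1, 2^{h+1} − c)`, for `c ≤ h + 1` and `c ≤ 2^h`. -/
theorem universalJoinWideLower_lift (h c : ℕ) (hch : c ≤ h + 1) (hc2 : c ≤ 2 ^ h)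
    (H : ∃ (m K : ℕ) (W : Fin m → ℕ) (wt : Fin m → Fin K → ℕ) (e : Fin (2 ^ h - c) → Fin m × Finset (Fin K)),
      m ≤ h + h ∧ K ≤ h * h * h ∧ Function.Injective e ∧
      (∀ x : Fin m × Finset (Fin K), x ∉ Set.range e →
        ∀ i, W (e i).1 + ∑ k ∈ (e i).2, wt (e i).1 k < W x.1 + ∑ k ∈ x.2, wt x.1 k) ∧
      ∀ u : Fin (2 ^ h - c) → Finset (Fin h), Function.Injective u → IsLowerSet (Set.range u) →
        ∃ tx : Fin m → Option (Fin K) → Fin h → ℂ,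
          (Matrix.of fun i k : Fin (2 ^ h - c) =>
            ∏ a ∈ u i, (tx (e k).1 none a + ∑ q ∈ (e k).2, tx (e k).1 (some q) a)).det ≠ 0) :
    ∃ (m K : ℕ) (W : Fin m → ℕ) (wt : Fin m → Fin K → ℕ) (e : Fin (2 ^ (h + 1) - c) → Fin m × Finset (Fin K)),
      m ≤ (h + 1) + (h + 1) ∧ K ≤ (h + 1) * (h + 1) * (h + 1) ∧ Function.Injective e ∧
      (∀ x : Fin m × Finset (Fin K), x ∉ Set.range e →
        ∀ i, W (e i).1 + ∑ k ∈ (e i).2, wt (e i).1 k < W x.1 + ∑ k ∈ x.2, wt x.1 k) ∧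
      ∀ u : Fin (2 ^ (h + 1) - c) → Finset (Fin (h + 1)), Function.Injective u → IsLowerSet (Set.range u) →
        ∃ tx : Fin m → Option (Fin K) → Fin (h + 1) → ℂ,
          (Matrix.of fun i k : Fin (2 ^ (h + 1) - c) =>
            ∏ a ∈ u i, (tx (e k).1 none a + ∑ q ∈ (e k).2, tx (e k).1 (some q) a)).det ≠ 0 := by
  classical
  obtain ⟨m, K, W, wt, e, hm, hK, he, hthr, hgood⟩ := H
  have hr : 2 ^ (h + 1) - c = 2 ^ h + (2 ^ h - c) := by rw [pow_succ]; omega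
  rw [hr]
  -- the cube columns: all subsets of `h` fresh states
  have hcardF : Fintype.card (Finset (Fin h)) = 2 ^ h := by simp
  let cube : Fin (2 ^ h) → Finset (Fin h) := fun i => (Fintype.equivFinOfCardEq hcardF).symm i
  have hcube_inj : Function.Injective cube := fun i j hij => (Fintype.equivFinOfCardEq hcardF).symm.injective hij
  have hcube_surj : Function.Surjective cube := (Fintype.equivFinOfCardEq hcardF).symm.surjective
  -- the new design: old pieces `castSucc p` on old states `castAdd h q`, the cube piece `last m` on fresh states `natAdd K j`
  let eC : Fin (2 ^ h) → Fin (m + 1) × Finset (Fin (K + h)) := fun i => (Fin.last m, (cube i).map (Fin.natAddEmb K))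
  let eO : Fin (2 ^ h - c) → Fin (m + 1) × Finset (Fin (K + h)) :=
    fun j => (Fin.castSuccEmb (e j).1, ((e j).2).map (Fin.castAddEmb h))
  let e' : Fin (2 ^ h + (2 ^ h - c)) → Fin (m + 1) × Finset (Fin (K + h)) := Fin.append eC eO
  have he'0 : ∀ i, e' (Fin.castAdd _ i) = eC i := fun i => Fin.append_left eC eO i
  have he'1 : ∀ j, e' (Fin.natAdd _ j) = eO j := fun j => Fin.append_right eC eO j
  have he' : Function.Injective e' := by
    refine Fin.append_injective_iff.mpr ⟨?_, ?_, ?_⟩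
    · intro i j hij
      exact hcube_inj (Finset.map_injective (Fin.natAddEmb K) (Prod.ext_iff.mp hij).2)
    · intro i j hij
      obtain ⟨h1, h2⟩ := Prod.ext_iff.mp hij
      exact he (Prod.ext (Fin.castSuccEmb.injective h1) (Finset.map_injective (Fin.castAddEmb h) h2))
    · intro i j hij
      have := (Prod.ext_iff.mp hij).1
      exact absurd this.symm (Fin.castSucc_lt_last (e j).1).ne
  -- weights
  obtain ⟨Ω, hΩdef⟩ : ∃ Ω : ℕ, Ω = 2 + ∑ i, (W (e i).1 + ∑ k ∈ (e i).2, wt (e i).1 k) := ⟨_, rfl⟩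
  have hΩ2 : 2 ≤ Ω := by rw [hΩdef]; omega
  have hΩ : ∀ i, W (e i).1 + ∑ k ∈ (e i).2, wt (e i).1 k + 1 < Ω := by
    intro i
    have := Finset.single_le_sum (f := fun i => W (e i).1 + ∑ k ∈ (e i).2, wt (e i).1 k) (fun _ _ => Nat.zero_le _)
      (Finset.mem_univ i)
    rw [hΩdef]; omega
  let W' : Fin (m + 1) → ℕ := Fin.snoc (fun p => W p + 1) 0
  let wt' : Fin (m + 1) → Fin (K + h) → ℕ :=
    Fin.snoc (fun p => fun k => Fin.addCases (fun q => wt p q) (fun _ => Ω) k) (fun k => Fin.addCases (fun _ => Ω) (fun _ => 0) k)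
  have hW'c : ∀ p, W' (Fin.castSucc p) = W p + 1 := fun p => by simp [W']
  have hW'l : W' (Fin.last m) = 0 := by simp [W']
  have hwt'cc : ∀ p q, wt' (Fin.castSucc p) (Fin.castAdd h q) = wt p q := fun p q => by simp [wt']
  have hwt'cn : ∀ p j, wt' (Fin.castSucc p) (Fin.natAdd K j) = Ω := fun p j => by simp [wt']
  have hwt'lc : ∀ q, wt' (Fin.last m) (Fin.castAdd h q) = Ω := fun q => by simp [wt']
  have hwt'ln : ∀ j, wt' (Fin.last m) (Fin.natAdd K j) = 0 := fun j => by simp [wt']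
  -- weights of the design columns
  have hwC : ∀ i, W' (eC i).1 + ∑ k ∈ (eC i).2, wt' (eC i).1 k = 0 := by
    intro i
    simp only [eC, hW'l, zero_add, Finset.sum_map]
    exact Finset.sum_eq_zero fun j _ => hwt'ln j
  have hwO : ∀ j, W' (eO j).1 + ∑ k ∈ (eO j).2, wt' (eO j).1 k = W (e j).1 + ∑ k ∈ (e j).2, wt (e j).1 k + 1 := by
    intro j
    simp only [eO, Fin.castSuccEmb_apply, hW'c, Finset.sum_map, Fin.castAddEmb_apply, hwt'cc]
    ring
  have hwdesign : ∀ i, W' (e' i).1 + ∑ k ∈ (e' i).2, wt' (e' i).1 k < Ω := by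
    intro i
    rcases SymbJoin.eq_castAdd_or_natAdd i with ⟨i, rfl⟩ | ⟨j, rfl⟩
    · rw [he'0, hwC]; omega
    · rw [he'1, hwO]; have := hΩ j; omega
  refine ⟨m + 1, K + h, W', wt', e', by omega, by nlinarith [Nat.zero_le h], he', ?_, ?_⟩
  · -- the joint strict threshold
    rintro ⟨p', J'⟩ hx i
    -- a state set all of whose members are fresh is the image of a subset of `Fin h`; similarly for old states
    have hsplit : ∀ k : Fin (K + h), (∃ q, k = Fin.castAdd h q) ∨ (∃ j, k = Fin.natAdd K j) := SymbJoin.eq_castAdd_or_natAdd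
    rcases Fin.eq_castSucc_or_eq_last p' with ⟨p, rfl⟩ | rfl
    · -- an old piece
      by_cases hfresh : ∃ k ∈ J', ∃ j, k = Fin.natAdd K j
      · obtain ⟨k, hk, j, rfl⟩ := hfresh
        have hge : Ω ≤ W' (Fin.castSucc p) + ∑ k ∈ J', wt' (Fin.castSucc p) k := by
          have := Finset.single_le_sum (f := fun k => wt' (Fin.castSucc p) k) (fun _ _ => Nat.zero_le _) hk
          rw [hwt'cn] at this; omega
        have := hwdesign i
        show _ < W' (Fin.castSucc p) + ∑ k ∈ J', wt' (Fin.castSucc p) k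
        omega
      · push Not at hfresh
        -- `J'` consists of old states
        let T : Finset (Fin K) := Finset.univ.filter fun q => Fin.castAdd h q ∈ J'
        have hT : T.map (Fin.castAddEmb h) = J' := by
          ext k
          simp only [Finset.mem_map, Finset.mem_filter, Finset.mem_univ, true_and, Fin.castAddEmb_apply, T]
          constructor
          · rintro ⟨q, hq, rfl⟩; exact hq
          · intro hk
            rcases hsplit k with ⟨q, rfl⟩ | ⟨j, rfl⟩
            · exact ⟨q, hk, rfl⟩
            · exact absurd rfl (hfresh _ hk j)
        have hnot : ((p, T) : Fin m × Finset (Fin K)) ∉ Set.range e := by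
          rintro ⟨j, hj⟩
          apply hx
          refine ⟨Fin.natAdd _ j, ?_⟩
          rw [he'1]
          simp only [eO, hj, Fin.castSuccEmb_apply, hT]
        have hwx : W' (Fin.castSucc p) + ∑ k ∈ J', wt' (Fin.castSucc p) k = W p + ∑ q ∈ T, wt p q + 1 := by
          rw [← hT, Finset.sum_map, hW'c]
          simp only [Fin.castAddEmb_apply, hwt'cc]
          ring
        show _ < W' (Fin.castSucc p) + ∑ k ∈ J', wt' (Fin.castSucc p) k
        rw [hwx]
        rcases SymbJoin.eq_castAdd_or_natAdd i with ⟨i, rfl⟩ | ⟨j, rfl⟩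
        · rw [he'0, hwC]; omega
        · rw [he'1, hwO]; have := hthr (p, T) hnot j; simp only at this; omega
    · -- the cube piece
      by_cases hold : ∃ k ∈ J', ∃ q, k = Fin.castAdd h q
      · obtain ⟨k, hk, q, rfl⟩ := hold
        have hge : Ω ≤ W' (Fin.last m) + ∑ k ∈ J', wt' (Fin.last m) k := by
          have := Finset.single_le_sum (f := fun k => wt' (Fin.last m) k) (fun _ _ => Nat.zero_le _) hk
          rw [hwt'lc] at this; omega
        have := hwdesign i
        show _ < W' (Fin.last m) + ∑ k ∈ J', wt' (Fin.last m) k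
        omega
      · push Not at hold
        exfalso
        apply hx
        let T : Finset (Fin h) := Finset.univ.filter fun j => Fin.natAdd K j ∈ J'
        have hT : T.map (Fin.natAddEmb K) = J' := by
          ext k
          simp only [Finset.mem_map, Finset.mem_filter, Finset.mem_univ, true_and, Fin.natAddEmb_apply, T]
          constructor
          · rintro ⟨j, hj, rfl⟩; exact hj
          · intro hk
            rcases hsplit k with ⟨q, rfl⟩ | ⟨j, rfl⟩
            · exact absurd rfl (hold _ hk q)
            · exact ⟨j, hk, rfl⟩
        obtain ⟨i₀, hi₀⟩ := hcube_surj T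
        refine ⟨Fin.castAdd _ i₀, ?_⟩
        rw [he'0]
        simp only [eC, hi₀, hT]
  · -- goodness: find a core coordinate and apply the symbolic lift
    intro u hu hlow
    -- the missing up-set has `c ≤ h + 1` members, hence a core coordinate
    set 𝒜 : Finset (Finset (Fin (h + 1))) := Finset.univ \ Finset.univ.image u with h𝒜
    have h𝒜c : 𝒜.card = c := by
      rw [h𝒜, Finset.card_sdiff_of_subset (Finset.subset_univ _), Finset.card_univ, Fintype.card_finset, Fintype.card_fin,
        Finset.card_image_of_injective _ hu, Finset.card_univ, Fintype.card_fin, pow_succ]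
      omega
    have hup : ∀ A ∈ 𝒜, ∀ A', A ⊆ A' → A' ∈ 𝒜 := by
      intro A hA A' hAA'
      rw [h𝒜, Finset.mem_sdiff] at hA ⊢
      refine ⟨Finset.mem_univ _, fun hA' => hA.2 ?_⟩
      obtain ⟨i, -, rfl⟩ := Finset.mem_image.mp hA'
      obtain ⟨j, hj⟩ := hlow hAA' ⟨i, rfl⟩
      exact Finset.mem_image.mpr ⟨j, Finset.mem_univ _, hj⟩
    have hcore : ∃ x : Fin (h + 1), ∀ A ∈ 𝒜, x ∈ A := by
      by_cases hc0 : 𝒜 = ∅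
      · exact ⟨0, by simp [hc0]⟩
      · have hB := FlagCells.card_noncore_succ_le 𝒜 hup (Finset.nonempty_iff_ne_empty.mpr hc0)
        rw [h𝒜c] at hB
        have hlt : (Finset.univ.filter fun x : Fin (h + 1) => ∃ A ∈ 𝒜, x ∉ A).card < (Finset.univ : Finset (Fin (h + 1))).card := by
          rw [Finset.card_univ, Fintype.card_fin]; omega
        obtain ⟨x, -, hx⟩ := Finset.exists_mem_notMem_of_card_lt_card hlt
        refine ⟨x, fun A hA => ?_⟩
        by_contra hxA
        exact hx (Finset.mem_filter.mpr ⟨Finset.mem_univ _, A, hA, hxA⟩)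
    obtain ⟨x, hxcore⟩ := hcore
    have hx : ∀ S : Finset (Fin (h + 1)), x ∉ S → S ∈ Set.range u := by
      intro S hS
      have : S ∉ 𝒜 := fun hS𝒜 => hS (hxcore S hS𝒜)
      rw [h𝒜, Finset.mem_sdiff, not_and, not_not] at this
      obtain ⟨i, -, hi⟩ := Finset.mem_image.mp (this (Finset.mem_univ _))
      exact ⟨i, hi⟩
    refine SymbJoin.exists_table_of_symGood u e' (SymbJoin.symGood_lift e ?_ u hu hlow x hx e' rfl
      (Fin.castAdd (2 ^ h - c)) (Fin.natAdd (2 ^ h)) ?_ (Fin.last m) (Finset.univ.map (Fin.natAddEmb K)) (by simp)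
      (fun i => (cube i).map (Fin.natAddEmb K)) ?_ ?_ he'0 Fin.castSuccEmb (Fin.castAddEmb h)
      (fun p => (Fin.castSucc_lt_last p).ne) he'1)
    · intro w hw hwlow
      obtain ⟨tx, htx⟩ := hgood w hw hwlow
      exact SymbJoin.symGood_of_table w e tx htx
    · have : Sum.elim (Fin.castAdd (2 ^ h - c)) (Fin.natAdd (2 ^ h)) = ⇑(finSumFinEquiv (m := 2 ^ h) (n := 2 ^ h - c)) := by
        funext i; rcases i with i | i <;> simp
      rw [this]; exact finSumFinEquiv.injective
    · intro i j hij; exact hcube_inj (Finset.map_injective _ hij)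
    · intro i; exact Finset.map_subset_map.mpr (Finset.subset_univ _)

end CoreLift

end

end Summit.ValiantsHypothesis.ValiantsHypothesis.Theorems.BarrierLever.HiddenStates
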